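import Literature.NumberTheory.QuadraticFields.ReducedIdealCycleOfClass
import Literature.NumberTheory.QuadraticFields.RealQuadraticUnits
import Literature.NumberTheory.QuadraticFields.IdealClassEpsteinSum
import Mathlib.NumberTheory.NumberField.ClassNumber
import HarnessLib

/-!
# The cycle of reduced ideals of an ideal class, II: the unit of a period; every class has many reduced ideals

Topic `NumberTheory/QuadraticFields`; continues `ReducedIdealCycleOfClass.lean` (the ideal
`𝔞(x) = Ideal.span {fa x, ω − (t − P)/2} = [Q/2, (P + √D)/2]` of `𝓞 K` attached to an ideal-shaped
quotient `x = (P + √D)/Q` in a `ℤ`-basis `(1, ω)`, `ω² = n + tω`, `t² + 4n = D`, and the baby-step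
relation `(A) 𝔞' = (η') 𝔞`). Pure-proof file (theorems only), following Jacobson–Williams,
*Solving the Pell Equation*, §5.3 (the cycle of reduced ideals of an arbitrary ideal class and the
regulator, Thm. 5.18 with (5.33)–(5.34)):

* `ringHom_gen`, `ringHom_gen_step`, `ringHom_unit_eq_psiProd` — under a real embedding `σ` with
  `σ(2ω − t) = √D`: `σ(η) = (P + √D)/2`, `σ(η_{k+1}) = A_k ψ_{k+1}`, hence a unit `u` with
  `(∏A_k) u = ∏η_{k+1}` has `σ(u) = ∏_{k=1}^{ℓ} ψ_k`;
* `mk0_span_fa_step`, `mk0_span_fa_iterate` — the cycle stays in the ideal class;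
* `exists_unit_of_iterate_eq` — over a period `ℓ` (`step^ℓ x = x`), `(∏A_k) u = ∏η_{k+1}` for a
  unit `u` (cancel `𝔞` in `(∏A) 𝔞 = (∏η) 𝔞`), and `log_fundUnit_le_period_mul`:
  **`ε_D ≤ ∏ ψ_k`, so `log ε_D ≤ ℓ · log(2√D)`** (`QuadIrr.fundUnit_le` + `φ < 2√D`);
* `exists_isReduced_mk0_eq` — **every class contains the ideal of a reduced ideal-shaped quotient**
  (Minkowski's bound `N𝔞 ≤ √d_K/2`, Mathlib `NumberField.exists_ideal_in_class_of_norm_le`; the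
  Hermite form `𝔞 = (g)(A, ω − k)` of `FormIdealsStructure.lean`; `QuadIrr.isReduced_normalize`);
* `exists_reduced_pairs_of_class` — **every ideal class of a real quadratic field contains at least
  `log ε_D / log(2√D)` reduced ideals** `[a, (b + √D)/2]`, listed injectively with their integer
  inequalities (the count behind op. cit. Thm. 5.18: the cycle of reduced ideals of a class has
  length `ℓ ≥ R / log(2√D)`).

## References

* M. J. Jacobson, Jr., H. C. Williams, *Solving the Pell Equation*, CMS Books in Mathematics,
  Springer (2009), §3.1, §5.1 Thm. 5.9, §5.3 Thm. 5.18 and (5.33)–(5.34). [JacobsonWilliams2008]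
* H. Cohen, *A Course in Computational Algebraic Number Theory*, GTM 138, Springer (1993), §5.6–5.7
  (reduced ideals and their cycles in real quadratic fields). [Cohen1993]
-/

noncomputable section

open Module NumberField Literature.Computability.Cryptography
open scoped Classical nonZeroDivisors NumberField

namespace Literature.NumberTheory.QuadraticFields.Quadratic

open QuadIrr

section Ring

variable {K : Type*} [Field K]
variable (b : Basis (Fin 2) ℤ (𝓞 K)) {t n : ℤ} {D : ℕ} (hDt : (D : ℤ) = t ^ 2 + 4 * n)
variable (σ : K →+* ℝ) (hσ : 2 * σ (b 1 : K) - t = Real.sqrt D)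

include hDt hσ in
/-- Under a real embedding with `σ(2ω − t) = √D`: `σ(η(x)) = (P + √D)/2`.
[cite: JacobsonWilliams2008, §5.3 (the ideal [Q/r, (P + √D)/r])] -/
theorem ringHom_gen {x : QuadIrr D} (h : x.IsIdealShaped) :
    σ ((b 1 - (((t - x.P) / 2 : ℤ) : 𝓞 K) : 𝓞 K) : K) = (x.P + Real.sqrt D) / 2 := by
  obtain ⟨k, C, -, -, hP, -, hη, -⟩ := exists_form_of_isIdealShaped b hDt h
  rw [hη, RingOfIntegers.coe_eq_algebraMap, map_sub, map_intCast, map_sub, map_intCast, hP,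
    ← RingOfIntegers.coe_eq_algebraMap]
  push_cast
  linarith

include hDt hσ in
/-- Under `σ`: `σ(η(x')) = A · ψ(x')` for the step `x ↦ x'` of a reduced ideal-shaped `x`
(`ψ' = Q'φ'/Q`, `A = Q/2`). [cite: JacobsonWilliams2008, §3.1 (ψ_k = Q_k φ_k/Q_{k−1})] -/
theorem ringHom_gen_step (hD : ¬ IsSquare D) {x : QuadIrr D} (h : x.IsIdealShaped) (hr : x.IsReduced) :
    σ ((b 1 - (((t - (step x).P) / 2 : ℤ) : 𝓞 K) : 𝓞 K) : K) = (fa x : ℝ) * psi (step x) := by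
  have h' : (step x).IsIdealShaped := h.step hD hr.isPreReduced
  rw [ringHom_gen b hDt σ hσ h', psi_step_eq hD h.isAdmissible (isReduced_step hD hr),
    Q_eq_two_mul_fa h]
  have hQ' : ((step x).Q : ℝ) ≠ 0 := by exact_mod_cast h'.1.ne'
  have ha0 : (fa x : ℝ) ≠ 0 := by
    have h1 := h.1
    have h2 := h.2.1
    have : fa x ≠ 0 := by unfold fa; omega
    exact_mod_cast this
  unfold val
  push_cast
  field_simp

include hDt hσ in
/-- **The unit of a period is `∏ ψ_k` under `σ`**: if `(∏A_j) u = ∏η_{j+1}` then, as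
`σ(η_{j+1}) = A_j ψ_{j+1}`, `σ(u) = ∏_{k=1}^{ℓ} ψ_k`. [cite: JacobsonWilliams2008, §5.3 (5.33)] -/
theorem ringHom_unit_eq_psiProd (hD : ¬ IsSquare D) {x : QuadIrr D} (h : x.IsIdealShaped) (hr : x.IsReduced)
    {ℓ : ℕ} (u : (𝓞 K)ˣ) (hu : (∏ j ∈ Finset.range ℓ, ((fa (step^[j] x) : ℤ) : 𝓞 K)) * u =
      ∏ j ∈ Finset.range ℓ, (b 1 - (((t - (step^[j + 1] x).P) / 2 : ℤ) : 𝓞 K))) :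
    σ ((u : 𝓞 K) : K) = psiProd x ℓ := by
  have h1 := congrArg (fun z : 𝓞 K => σ (z : K)) hu
  simp only [map_mul, map_prod, map_intCast] at h1
  have h2 : ∀ j ∈ Finset.range ℓ, σ ((b 1 - (((t - (step^[j + 1] x).P) / 2 : ℤ) : 𝓞 K) : 𝓞 K) : K) =
      (fa (step^[j] x) : ℝ) * psi (step^[j + 1] x) := fun j _ => by
    rw [Function.iterate_succ_apply']
    exact ringHom_gen_step b hDt σ hσ hD (h.iterate hD hr j) (isReduced_iterate hD hr j)
  rw [Finset.prod_congr rfl h2, Finset.prod_mul_distrib] at h1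
  have hne : (∏ j ∈ Finset.range ℓ, (fa (step^[j] x) : ℝ)) ≠ 0 := by
    refine Finset.prod_ne_zero_iff.mpr fun j _ => ?_
    have h3 := h.iterate hD hr j
    have : fa (step^[j] x) ≠ 0 := by have := h3.1; have := h3.2.1; unfold fa; omega
    exact_mod_cast this
  exact mul_left_cancel₀ hne h1

end Ring

section Field

variable {K : Type*} [Field K] [NumberField K]
variable (b : Basis (Fin 2) ℤ (𝓞 K)) (hb : b 0 = 1) {t n : ℤ} (hω : b 1 * b 1 = (n : 𝓞 K) + (t : 𝓞 K) * b 1)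
variable {D : ℕ} (hDt : (D : ℤ) = t ^ 2 + 4 * n)

include hb hω hDt in
/-- **The baby step does not change the ideal class**: `[𝔞(step x)] = [𝔞(x)]` for a reduced
ideal-shaped `x`. [cite: JacobsonWilliams2008, §5.3 (the cycle of reduced ideals of a class)] -/
theorem mk0_span_fa_step (hD : ¬ IsSquare D) {x : QuadIrr D} (h : x.IsIdealShaped) (hr : x.IsReduced)
    (hI : Ideal.span {((fa x : ℤ) : 𝓞 K), b 1 - (((t - x.P) / 2 : ℤ) : 𝓞 K)} ∈ (Ideal (𝓞 K))⁰)
    (hI' : Ideal.span {((fa (step x) : ℤ) : 𝓞 K), b 1 - (((t - (step x).P) / 2 : ℤ) : 𝓞 K)} ∈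
      (Ideal (𝓞 K))⁰) :
    ClassGroup.mk0 ⟨_, hI'⟩ = ClassGroup.mk0 ⟨_, hI⟩ := by
  have h' : (stepWith x x.pq).IsIdealShaped := h.step hD hr.isPreReduced
  rw [ClassGroup.mk0_eq_mk0_iff]
  refine ⟨((fa x : ℤ) : 𝓞 K), b 1 - (((t - (step x).P) / 2 : ℤ) : 𝓞 K), ?_, gen_ne_zero b hb _, ?_⟩
  · intro h0
    have h0' := intCast_eq_zero_of_basis b hb h0
    have h1 := h.1
    have h2 := h.2.1
    unfold fa at h0'
    omega
  · exact span_fa_mul_span_fa_stepWith b hω hDt h _ h'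

include hb hω hDt in
/-- All ideals along the cycle of a reduced ideal-shaped `x` lie in the class of `𝔞(x)`.
[cite: JacobsonWilliams2008, §5.3 (the cycle of reduced ideals of a class)] -/
theorem mk0_span_fa_iterate (hD : ¬ IsSquare D) (m : ℕ) :
    ∀ {x : QuadIrr D}, x.IsIdealShaped → x.IsReduced →
      ∀ (hI : Ideal.span {((fa x : ℤ) : 𝓞 K), b 1 - (((t - x.P) / 2 : ℤ) : 𝓞 K)} ∈ (Ideal (𝓞 K))⁰)
        (hIm : Ideal.span {((fa (step^[m] x) : ℤ) : 𝓞 K), b 1 - (((t - (step^[m] x).P) / 2 : ℤ) : 𝓞 K)} ∈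
          (Ideal (𝓞 K))⁰), ClassGroup.mk0 ⟨_, hIm⟩ = ClassGroup.mk0 ⟨_, hI⟩ := by
  induction m with
  | zero => intro x _ _ hI hIm; rfl
  | succ m ih =>
    intro x h hr hI hIm
    have h1 : (step x).IsIdealShaped := h.step hD hr.isPreReduced
    have hr1 : (step x).IsReduced := isReduced_step hD hr
    have hI1 := span_fa_mem_nonZeroDivisors b hb (t := t) h1.1 h1.2.1
    exact (ih h1 hr1 hI1 hIm).trans (mk0_span_fa_step b hb hω hDt hD h hr hI hI1)

include hb hω hDt in
/-- **The product of the generators over a period is a unit times the product of the norms**: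
if `step^ℓ x = x` then `A₀⋯A_{ℓ−1} · u = η₁⋯η_ℓ` for a unit `u` of `𝓞 K` (cancel `𝔞(x)` in
`(∏A) 𝔞 = (∏η) 𝔞`). [cite: JacobsonWilliams2008, §5.3 (5.33) (ε = θ_{p+1})] -/
theorem exists_unit_of_iterate_eq (hD : ¬ IsSquare D) {x : QuadIrr D} (h : x.IsIdealShaped) (hr : x.IsReduced)
    {ℓ : ℕ} (hℓ : step^[ℓ] x = x) :
    ∃ u : (𝓞 K)ˣ, (∏ j ∈ Finset.range ℓ, ((fa (step^[j] x) : ℤ) : 𝓞 K)) * u =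
      ∏ j ∈ Finset.range ℓ, (b 1 - (((t - (step^[j + 1] x).P) / 2 : ℤ) : 𝓞 K)) := by
  have hchain := span_prod_fa_mul_span_fa_iterate b hω hDt hD h hr ℓ
  rw [hℓ] at hchain
  have hI0 : Ideal.span {((fa x : ℤ) : 𝓞 K), b 1 - (((t - x.P) / 2 : ℤ) : 𝓞 K)} ≠ 0 :=
    nonZeroDivisors.ne_zero (span_fa_mem_nonZeroDivisors b hb h.1 h.2.1)
  exact Ideal.span_singleton_eq_span_singleton.mp (mul_right_cancel₀ hI0 hchain)

variable (σ : K →+* ℝ) (hσ : 2 * σ (b 1 : K) - t = Real.sqrt D)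

include hb hω hDt hσ in
/-- **The period of the cycle of a reduced ideal controls the regulator**: for a reduced
ideal-shaped `x` with period `ℓ`, `ε_D = fundUnit D ≤ ∏_{k=1}^{ℓ} ψ_k` (the unit of the period is
`≥` the fundamental unit), hence `log ε_D ≤ ℓ · log(2√D)`. [cite: JacobsonWilliams2008, §5.3 (5.33)–(5.34)] -/
theorem log_fundUnit_le_period_mul (hD : ¬ IsSquare D) (hD4 : D % 4 = 0 ∨ D % 4 = 1) {x : QuadIrr D}
    (h : x.IsIdealShaped) (hr : x.IsReduced) :
    fundUnit D ≤ psiProd x (Function.minimalPeriod step x) ∧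
      Real.log (fundUnit D) ≤ Function.minimalPeriod step x * Real.log (2 * Real.sqrt D) := by
  set ℓ := Function.minimalPeriod step x with hℓdef
  have hℓ : step^[ℓ] x = x := Function.iterate_minimalPeriod
  have hℓpos : 0 < ℓ := minimalPeriod_pos hD hr
  obtain ⟨u, hu⟩ := exists_unit_of_iterate_eq b hb hω hDt hD h hr hℓ
  have hσu := ringHom_unit_eq_psiProd b hDt σ hσ hD h hr u hu
  have hgt : 1 < psiProd x ℓ := by
    obtain ⟨m, hm⟩ : ∃ m, ℓ = m + 1 := ⟨ℓ - 1, by omega⟩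
    rw [hm]; exact hr.isPreReduced.one_lt_psiProd_succ hD m
  have hu1 : 1 < σ ((u : 𝓞 K) : K) := by rw [hσu]; exact hgt
  obtain ⟨X, Y, hX, hY, hXY, hval⟩ := exists_sq_sub_eq_of_one_lt b hb hω σ u hu1
  rw [← hDt] at hXY hval
  have hle : fundUnit D ≤ psiProd x ℓ := by
    rw [← hσu, hval]; push_cast
    exact fundUnit_le hD hD4 hX hY hXY
  refine ⟨hle, ?_⟩
  have hε := one_lt_fundUnit hD hD4
  calc Real.log (fundUnit D) ≤ Real.log (psiProd x ℓ) := Real.log_le_log (by linarith) hle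
    _ = Real.log (valProd x ℓ) := by rw [psiProd_eq_valProd_of_iterate_eq hD hr hℓ]
    _ ≤ ℓ * Real.log (2 * Real.sqrt D) := hr.isPreReduced.log_valProd_le hD ℓ

include hb hω hDt in
/-- **Every ideal class contains the ideal of a reduced ideal-shaped quotient**: Minkowski gives
`𝔞 ∈ C` with `N𝔞 ≤ √D/2`; its Hermite form is `𝔞 = (g)(A, ω − k)` with `A ≤ N𝔞 < √D/2`, so
`x' = (t − 2k, 2A)` has `0 < Q < √D` and `normalize x'` is reduced with the same ideal.
[cite: JacobsonWilliams2008, §5.1 Thm. 5.9 (3)] -/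
theorem exists_isReduced_mk0_eq (hD : ¬ IsSquare D) (h2 : finrank ℚ K = 2)
    (hdisc : NumberField.discr K = D) (C : ClassGroup (𝓞 K)) :
    ∃ x : QuadIrr D, x.IsIdealShaped ∧ x.IsReduced ∧
      ∃ hI : Ideal.span {((fa x : ℤ) : 𝓞 K), b 1 - (((t - x.P) / 2 : ℤ) : 𝓞 K)} ∈ (Ideal (𝓞 K))⁰,
        ClassGroup.mk0 ⟨_, hI⟩ = C := by
  have hD0 : D ≠ 0 := by rintro rfl; exact hD ⟨0, rfl⟩
  have hd : 0 < NumberField.discr K := by rw [hdisc]; exact_mod_cast Nat.pos_of_ne_zero hD0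
  obtain ⟨I, hIC, hIN⟩ := NumberField.exists_ideal_in_class_of_norm_le C
  obtain ⟨-, hc0⟩ := nrRealPlaces_eq_two_and_nrComplexPlaces_eq_zero h2 hd
  rw [hc0, h2, hdisc] at hIN
  have hIN' : (Ideal.absNorm (I : Ideal (𝓞 K)) : ℝ) ≤ Real.sqrt D / 2 := by
    have habs : |((D : ℤ) : ℝ)| = (D : ℝ) := by push_cast; exact abs_of_nonneg (Nat.cast_nonneg _)
    rw [habs, Nat.factorial_two, pow_zero, one_mul] at hIN
    refine hIN.trans (le_of_eq ?_)
    norm_num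
    ring
  have hI0 : (I : Ideal (𝓞 K)) ≠ ⊥ := nonZeroDivisors.coe_ne_zero I
  obtain ⟨g, A, k, C', hg, hA, hAC, hIeq⟩ := exists_eq_span_singleton_mul_span_pair b hb hω hI0
  -- `A ≤ N(I) ≤ √D/2`
  have hnorm : (A : ℝ) ≤ Ideal.absNorm (I : Ideal (𝓞 K)) := by
    have hg0 : Ideal.absNorm (Ideal.span {((g : ℤ) : 𝓞 K)}) ≠ 0 := by
      rw [Ne, Ideal.absNorm_eq_zero_iff, Ideal.span_singleton_eq_bot]
      intro h0
      have := intCast_eq_zero_of_basis b hb h0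
      omega
    have h1 : Ideal.absNorm (I : Ideal (𝓞 K)) = Ideal.absNorm (Ideal.span {((g : ℤ) : 𝓞 K)}) * A.natAbs := by
      rw [hIeq, map_mul, absNorm_span_pair_eq b hb hω hAC]
    have h2' : A.natAbs ≤ Ideal.absNorm (I : Ideal (𝓞 K)) := by
      rw [h1]; exact Nat.le_mul_of_pos_left _ (Nat.pos_of_ne_zero hg0)
    have h3 : ((A.natAbs : ℕ) : ℝ) = A := by
      rw [← Int.cast_natCast (R := ℝ), Int.natAbs_of_nonneg hA.le]
    rw [← h3]
    exact_mod_cast h2'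
  -- `2A < √D`
  have h2A : ((2 * A : ℤ) : ℝ) < Real.sqrt D := by
    have hle : ((2 * A : ℤ) : ℝ) ≤ Real.sqrt D := by push_cast; linarith
    exact lt_of_le_of_ne hle (Ne.symm (sqrt_ne_intCast hD _))
  -- the quotient `(t − 2k, 2A)` of the lattice `(A, ω − k)`
  set x' : QuadIrr D := ⟨t - 2 * k, 2 * A⟩ with hx'
  have hx's : x'.IsIdealShaped := by
    refine ⟨show 0 < 2 * A by omega, ⟨A, rfl⟩, ⟨C', ?_⟩⟩
    show (t - 2 * k) ^ 2 - (D : ℤ) = 2 * (2 * A) * C'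
    linear_combination (-1 : ℤ) * hDt + (-4 : ℤ) * hAC
  have hIx' : Ideal.span {((fa x' : ℤ) : 𝓞 K), b 1 - (((t - x'.P) / 2 : ℤ) : 𝓞 K)} =
      Ideal.span {(A : 𝓞 K), b 1 - k} := by
    show Ideal.span {(((2 * A) / 2 : ℤ) : 𝓞 K), b 1 - (((t - (t - 2 * k)) / 2 : ℤ) : 𝓞 K)} = _
    rw [show (2 * A) / 2 = A by omega, show (t - (t - 2 * k)) / 2 = k by omega]
  have hn := InfraPrimitives.isIdealShaped_normalize hx's
  refine ⟨QuadIrr.normalize x', hn, isReduced_normalize hD hx's.isAdmissible hx's.1 h2A,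
    span_fa_mem_nonZeroDivisors b hb hn.1 hn.2.1, ?_⟩
  rw [← hIC, ClassGroup.mk0_eq_mk0_iff]
  refine ⟨(g : 𝓞 K), 1, ?_, one_ne_zero, ?_⟩
  · intro h0
    have := intCast_eq_zero_of_basis b hb h0
    omega
  · show Ideal.span {((g : ℤ) : 𝓞 K)} * Ideal.span {((fa (QuadIrr.normalize x') : ℤ) : 𝓞 K),
        b 1 - (((t - (QuadIrr.normalize x').P) / 2 : ℤ) : 𝓞 K)} = Ideal.span {1} * (I : Ideal (𝓞 K))
    rw [span_fa_normalize b hDt hx's, hIx', Ideal.span_singleton_one, Ideal.top_mul, hIeq]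

include hb hω hDt hσ in
/-- **Every ideal class of a real quadratic field contains at least `log ε_D / log(2√D)` reduced
ideals `[a, (b + √D)/2]`** (`a, b ≥ 1`, `b < √D < 2a + b`, `|2a − b| < √D`, `4a ∣ D − b²`), listed
injectively by the cycle `k ↦ (Q_k/2, P_k)`, `k < ℓ`, of a reduced representative, with
`log ε_D ≤ ℓ log(2√D)`. [cite: JacobsonWilliams2008, §5.3 Thm. 5.18, (5.33)] -/
theorem exists_reduced_pairs_of_class (hD : ¬ IsSquare D) (hD4 : D % 4 = 0 ∨ D % 4 = 1)
    (h2 : finrank ℚ K = 2) (hdisc : NumberField.discr K = D) (C : ClassGroup (𝓞 K)) :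
    ∃ (ℓ : ℕ) (f : Fin ℓ → ℕ × ℕ), Function.Injective f ∧
      Real.log (fundUnit D) ≤ ℓ * Real.log (2 * Real.sqrt D) ∧
      ∀ i, (0 < (f i).1 ∧ 0 < (f i).2 ∧ (f i).2 ^ 2 < D ∧ 4 * (f i).1 ∣ D - (f i).2 ^ 2 ∧
          D < (2 * (f i).1 + (f i).2) ^ 2 ∧ (2 * (f i).1 ≤ (f i).2 ∨ (2 * (f i).1 - (f i).2) ^ 2 < D)) ∧
        ∃ hI : Ideal.span {((f i).1 : 𝓞 K), b 1 - ((((t - (f i).2) / 2 : ℤ)) : 𝓞 K)} ∈ (Ideal (𝓞 K))⁰,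
          ClassGroup.mk0 ⟨_, hI⟩ = C := by
  obtain ⟨x, hs, hr, hI, hC⟩ := exists_isReduced_mk0_eq b hb hω hDt hD h2 hdisc C
  obtain ⟨-, hlog⟩ := log_fundUnit_le_period_mul b hb hω hDt σ hσ hD hD4 hs hr
  refine ⟨Function.minimalPeriod step x,
    fun i => ((fa (step^[(i : ℕ)] x)).toNat, (step^[(i : ℕ)] x).P.toNat), ?_, hlog, fun i =>
    ⟨(isReduced_iterate hD hr i).pair_spec (hs.iterate hD hr i), ?_⟩⟩
  · intro i j hij
    have heq := pair_inj (isReduced_iterate hD hr i) (hs.iterate hD hr i) (isReduced_iterate hD hr j)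
      (hs.iterate hD hr j) hij
    exact Fin.ext ((Function.iterate_eq_iterate_iff_of_lt_minimalPeriod i.2 j.2).mp heq)
  · have hsi := hs.iterate hD hr i
    have hri := isReduced_iterate hD hr i
    obtain ⟨hfa, hP⟩ := hri.pair_cast hsi
    set y := step^[(i : ℕ)] x with hy
    have e1 : ((fa y : ℤ) : 𝓞 K) = (((fa y).toNat : ℕ) : 𝓞 K) := by
      rw [← Int.cast_natCast, hfa]
    have hIeq : Ideal.span {(((fa y).toNat : ℕ) : 𝓞 K), b 1 - ((((t - ((y.P.toNat : ℕ) : ℤ)) / 2 : ℤ)) : 𝓞 K)} =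
        Ideal.span {((fa y : ℤ) : 𝓞 K), b 1 - (((t - y.P) / 2 : ℤ) : 𝓞 K)} := by
      rw [hP, e1]
    have hmem := span_fa_mem_nonZeroDivisors b hb (t := t) hsi.1 hsi.2.1
    refine ⟨hIeq ▸ hmem, ?_⟩
    rw [← hC, ← mk0_span_fa_iterate b hb hω hDt hD i hs hr hI hmem]
    congr 1
    exact Subtype.ext hIeq

end Field

end Literature.NumberTheory.QuadraticFields.Quadratic

end
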